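import Summits.BirchSwinnertonDyer.BirchSwinnertonDyer.Theorems.ByReductionTypeAtTwoRankOneAtTwoBigImageOddLocalOneDoorValuation
import HarnessLib

/-!
# Route ByReductionTypeAtTwo, crux `RankOneAtTwoBigImageOddLocal` (stmt-BirchSwinnertonDyer-23715), LINE v8.5 `one_door_analytic`:
# the HALVES of the door law AN-28c at a door datum — Euler-system half, main-conjecture half, `2`-integrality

Width prover seat `bsd-line-fkl-p2` g8 (2026-08-28), `--supports stmt-BirchSwinnertonDyer-23715`.  THEOREMS ONLY; nothing is
asserted; BSD is not proved by any of this.  Sequel of `…OneDoorValuation.lean` (`doorValuationC_at`: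
`ord₂ #Ш_an(W) = 2m + [Δ_W<0] − s_d − t − 2s − 2·v₂(c)` at a door datum).

In Miller's currency the `2`-part of BSD splits as `MissingUpperBoundAt W 2` («Euler-system half»: `ord₂ #Ш(W) ≤ ord₂ #Ш_an(W)`) and
`MissingLowerBoundAt W 2` («main-conjecture half»: `ord₂ #Ш_an(W) ≤ ord₂ #Ш(W)`) (`Literature…Rank1Residual.Typed.Basic`).  At a
door datum (hypotheses of `doorValuationC_at`: `W` on the slice with `rank E(ℚ) = 1`, `K` door-admissible Heegner field with
`L(E^{(d_K)},1) ≠ 0`, ANY datum `Dt`, `P` the Heegner point, `Wd` minimal twin with `BSD(Wd,2)`, GZ/Kolyvagin/modularity):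

* `missingUpperBoundAt_two_iff_doorLawGeC_at` — upper half ⟺ **`s_E + s_d + t + 2s + 2·v₂(c) ≤ 2m + [Δ_W<0]`**: the Heegner point is
  divisible ENOUGH (over `K` this is Kolyvagin's direction `ord₂ #Ш(E_K) ≤ 2·ord₂[E(K):ℤy_K] − 2v₂(c)`: `Ш` is no larger than the
  index predicts);
* `missingLowerBoundAt_two_iff_doorLawLeC_at` — lower half ⟺ **`2m + [Δ_W<0] ≤ s_E + s_d + t + 2s + 2·v₂(c)`**: the Heegner point is
  NOT divisible beyond the prediction (the `2`-adic Gross–Zagier / main-conjecture direction);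
* `padicValRat_shaAn_nonneg_iff_doorLawIntC_at` — `#Ш_an(W)` is a `2`-adic INTEGER ⟺ `s_d + t + 2s + 2·v₂(c) ≤ 2m + [Δ_W<0]` (the old
  fkl residue (5b) `RankOneAtTwoFkl.ShaAnTwoIntegralOnBigImageSlice` read at one curve); implied by the upper half
  (`padicValRat_shaAn_nonneg_of_missingUpperBoundAt_at`);
* `doorLawFullC_at_iff_geC_and_leC` — AN-28c at the datum ⟺ both one-sided laws (the exponent is unique);
* `bsdp_iff_missingLowerBoundAt_and_missingUpperBoundAt` / `bsdp_two_iff_halves_of_rankOne` — with the rank part and finiteness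
  known (the whole slice), `BSDp W p` ⟺ both halves.

Why.  The two halves sit on the two sides of the classical divide.  Over `K` the upper half is an Euler-system UPPER BOUND at `2`
(not in print: Kolyvagin 1990 Thm. A carries a `2`-power error term; but weaker than the exactness crux `KolyvaginExactAtTwo` of
route GenusKolyvaginAtTwo), the lower half is the `2`-adic Gross–Zagier / main-conjecture direction; the companion
`…OneDoorHalvesK.lean` transports each half from `K` to `ℚ` (the `2`-adic BSD defect is invariant under the quadratic descent,
`AdditivePotMult.missingUpperBoundAt_iff_overC`) and puts the residue (5b) under the upper half BY NAME on the whole slice.  A violation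
of AN-28c, if any, is one-sided, and by the lead's parity layer (`…OneDoorParity.lean`, p624716) of even defect.

References: [GrossZagier1986] Thm. I.6.3, V.§2; [GrossLMS1991] Thm. 1.3, §2 Conj. (2.2); [KolyvaginEulerSystems1990] Thm. A;
[Miller2011LMS] Def. 1.1.
-/

set_option autoImplicit false

noncomputable section

open scoped Classical

set_option linter.dupNamespace false

namespace Summit.BirchSwinnertonDyer.BirchSwinnertonDyer.Theorems.RankOneAtTwoOneDoor

open WeierstrassCurve NumberField IsDedekindDomain Rat.HeightOneSpectrum Literature.NumberTheory.EllipticCurves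
  Literature.NumberTheory.EllipticCurves.ModularForms
  Literature.NumberTheory.EllipticCurves.KrizLi2019
  Literature.NumberTheory.EllipticCurves.Rank1Residual.Typed
  Summit.BirchSwinnertonDyer.Rank1Residual.F1Sign2
  Summit.BirchSwinnertonDyer.Rank1Residual.F1Sign2.TranspositionDoor
  Summit.BirchSwinnertonDyer.Rank1Residual

/-! ### §2 The halves at a door datum -/


/-- **THE EULER-SYSTEM HALF at a door datum**: in the setting of `doorValuationC_at`, `ord₂ #Ш(W) ≤ ord₂ #Ш_an(W)`
(`Typed.MissingUpperBoundAt W 2`) iff the Heegner point is divisible ENOUGH: for its exponent `m`,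
`s_E + s_d + t + 2s + 2·v₂(c) ≤ 2m + [Δ_W < 0]`.  (Over `K`: Kolyvagin's direction `ord₂ #Ш(E_K) ≤ 2 ord₂ [E(K):ℤy_K] − 2v₂(c)`.)
[cite: GrossLMS1991, Thm. 1.3 and Conj. (2.2)] [cite: Miller2011LMS, Def. 1.1] -/
theorem missingUpperBoundAt_two_iff_doorLawGeC_at
    (hmod : hasEntireLFunction_rat) (hTam : DoorTwistTamagawaAtTwo)
    (W : WeierstrassCurve ℚ) [W.IsElliptic] [W.IsGloballyMinimal] [NeZero (W.conductorNorm ℤ)]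
    (hT : Odd W.torsionOrder) (hc : Odd W.tamagawaProduct) (hr : W.analyticRank = 1) (hrQ : W.mordellWeilRank = 1)
    (K : Type) [Field K] [NumberField K] (hK : IsImaginaryQuadratic K)
    (hGZ : gross_zagier (W.conductorNorm ℤ) W K) (hKo : kolyvagin (W.conductorNorm ℤ) W K)
    (hadm : DoorAdmissible W (NumberField.discr K))
    (hHN : SatisfiesHeegnerHypothesis (W.conductorNorm ℤ) K)
    (hLt : (W.quadraticTwist (NumberField.discr K : ℚ)).entireLFunction 1 ≠ 0)
    (Dt : ModularParametrizationData W (W.conductorNorm ℤ))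
    (H : HeegnerDatum (W.conductorNorm ℤ) (NumberField.discr K)) (ι : K →+* ℂ)
    (P : (W.baseChange K).toAffine.Point)
    (hP : WeierstrassCurve.Affine.Point.map ι.toRatAlgHom P = heegnerPointComplex Dt H)
    (Wd : WeierstrassCurve ℚ) [Wd.IsElliptic] [Wd.IsGloballyMinimal] (Cd : VariableChange ℚ)
    (hWd : Cd • W.quadraticTwist (NumberField.discr K : ℚ) = Wd) (hBd : BSDp Wd 2) :
    MissingUpperBoundAt W 2 ↔
      ∃ m : ℕ, HasTwoDivisibilityUpToTorsion W K P m ∧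
        padicValNat 2 (Nat.card (AddCommGroup.primaryComponent W.sha 2)) +
            padicValNat 2 (Nat.card (AddCommGroup.primaryComponent Wd.sha 2)) +
            transpCount W (NumberField.discr K) + 2 * identCount W (NumberField.discr K) + 2 * padicValInt 2 Dt.c ≤
          2 * m + (if W.Δ < 0 then 1 else 0) := by
  haveI : Fact (Nat.Prime 2) := ⟨Nat.prime_two⟩
  obtain ⟨hfinW, -, -, -, ⟨m, hm⟩, huniq, q, hq, -, hval⟩ :=
    doorValuationC_at hmod hTam W hT hc hr hrQ K hK hGZ hKo hadm hHN hLt Dt H ι P hP Wd Cd hWd hBd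
  haveI := hfinW
  have hprim : padicValNat 2 (Nat.card (AddCommGroup.primaryComponent W.sha 2)) = padicValNat 2 W.shaOrder := by
    rw [WeierstrassCurve.shaOrder, padicValNat_card_addPrimaryComponent]
  have hv := hval m hm
  constructor
  · rintro ⟨q₁, hq₁, hle⟩
    have hqq : q₁ = q := by exact_mod_cast hq₁.symm.trans hq
    subst hqq
    refine ⟨m, hm, ?_⟩
    rw [← hprim] at hle
    zify
    push_cast at hv hle ⊢
    linarith
  · rintro ⟨m', hm', hle⟩
    have hmm : m' = m := huniq m' m hm' hm
    subst hmm
    refine ⟨q, hq, ?_⟩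
    rw [← hprim, hv]
    zify at hle
    push_cast at hle ⊢
    linarith

/-- **THE MAIN-CONJECTURE HALF at a door datum**: in the setting of `doorValuationC_at`, `ord₂ #Ш_an(W) ≤ ord₂ #Ш(W)`
(`Typed.MissingLowerBoundAt W 2`) iff the Heegner point is NOT divisible beyond the prediction: for its exponent `m`,
`2m + [Δ_W < 0] ≤ s_E + s_d + t + 2s + 2·v₂(c)`.  (Over `K`: the `2`-adic Gross–Zagier / main-conjecture direction
`2 ord₂ [E(K):ℤy_K] − 2v₂(c) ≤ ord₂ #Ш(E_K)`.) [cite: GrossLMS1991, Conj. (2.2)] [cite: Miller2011LMS, Def. 1.1] -/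
theorem missingLowerBoundAt_two_iff_doorLawLeC_at
    (hmod : hasEntireLFunction_rat) (hTam : DoorTwistTamagawaAtTwo)
    (W : WeierstrassCurve ℚ) [W.IsElliptic] [W.IsGloballyMinimal] [NeZero (W.conductorNorm ℤ)]
    (hT : Odd W.torsionOrder) (hc : Odd W.tamagawaProduct) (hr : W.analyticRank = 1) (hrQ : W.mordellWeilRank = 1)
    (K : Type) [Field K] [NumberField K] (hK : IsImaginaryQuadratic K)
    (hGZ : gross_zagier (W.conductorNorm ℤ) W K) (hKo : kolyvagin (W.conductorNorm ℤ) W K)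
    (hadm : DoorAdmissible W (NumberField.discr K))
    (hHN : SatisfiesHeegnerHypothesis (W.conductorNorm ℤ) K)
    (hLt : (W.quadraticTwist (NumberField.discr K : ℚ)).entireLFunction 1 ≠ 0)
    (Dt : ModularParametrizationData W (W.conductorNorm ℤ))
    (H : HeegnerDatum (W.conductorNorm ℤ) (NumberField.discr K)) (ι : K →+* ℂ)
    (P : (W.baseChange K).toAffine.Point)
    (hP : WeierstrassCurve.Affine.Point.map ι.toRatAlgHom P = heegnerPointComplex Dt H)
    (Wd : WeierstrassCurve ℚ) [Wd.IsElliptic] [Wd.IsGloballyMinimal] (Cd : VariableChange ℚ)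
    (hWd : Cd • W.quadraticTwist (NumberField.discr K : ℚ) = Wd) (hBd : BSDp Wd 2) :
    MissingLowerBoundAt W 2 ↔
      ∃ m : ℕ, HasTwoDivisibilityUpToTorsion W K P m ∧
        2 * m + (if W.Δ < 0 then 1 else 0) ≤
          padicValNat 2 (Nat.card (AddCommGroup.primaryComponent W.sha 2)) +
            padicValNat 2 (Nat.card (AddCommGroup.primaryComponent Wd.sha 2)) +
            transpCount W (NumberField.discr K) + 2 * identCount W (NumberField.discr K) + 2 * padicValInt 2 Dt.c := by
  haveI : Fact (Nat.Prime 2) := ⟨Nat.prime_two⟩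
  obtain ⟨hfinW, -, -, -, ⟨m, hm⟩, huniq, q, hq, -, hval⟩ :=
    doorValuationC_at hmod hTam W hT hc hr hrQ K hK hGZ hKo hadm hHN hLt Dt H ι P hP Wd Cd hWd hBd
  haveI := hfinW
  have hprim : padicValNat 2 (Nat.card (AddCommGroup.primaryComponent W.sha 2)) = padicValNat 2 W.shaOrder := by
    rw [WeierstrassCurve.shaOrder, padicValNat_card_addPrimaryComponent]
  have hv := hval m hm
  constructor
  · rintro ⟨q₁, hq₁, hle⟩
    have hqq : q₁ = q := by exact_mod_cast hq₁.symm.trans hq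
    subst hqq
    refine ⟨m, hm, ?_⟩
    rw [← hprim] at hle
    zify
    push_cast at hv hle ⊢
    linarith
  · rintro ⟨m', hm', hle⟩
    have hmm : m' = m := huniq m' m hm' hm
    subst hmm
    refine ⟨q, hq, ?_⟩
    rw [← hprim, hv]
    zify at hle
    push_cast at hle ⊢
    linarith

/-- **`2`-INTEGRALITY OF `#Ш_an(W)` at a door datum** (the old fkl residue (5b) `ShaAnTwoIntegralOnBigImageSlice` read at one curve):
every rational value of `#Ш_an(W)` has `ord₂ ≥ 0` iff `s_d + t + 2s + 2·v₂(c) ≤ 2m + [Δ_W < 0]` for the exponent `m` of the Heegner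
point — weaker than the Euler-system half by exactly `s_E = ord₂ #Ш(W)[2^∞]`. [cite: GrossZagier1986, V.§2] [cite: Miller2011LMS, Def. 1.1] -/
theorem padicValRat_shaAn_nonneg_iff_doorLawIntC_at
    (hmod : hasEntireLFunction_rat) (hTam : DoorTwistTamagawaAtTwo)
    (W : WeierstrassCurve ℚ) [W.IsElliptic] [W.IsGloballyMinimal] [NeZero (W.conductorNorm ℤ)]
    (hT : Odd W.torsionOrder) (hc : Odd W.tamagawaProduct) (hr : W.analyticRank = 1) (hrQ : W.mordellWeilRank = 1)
    (K : Type) [Field K] [NumberField K] (hK : IsImaginaryQuadratic K)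
    (hGZ : gross_zagier (W.conductorNorm ℤ) W K) (hKo : kolyvagin (W.conductorNorm ℤ) W K)
    (hadm : DoorAdmissible W (NumberField.discr K))
    (hHN : SatisfiesHeegnerHypothesis (W.conductorNorm ℤ) K)
    (hLt : (W.quadraticTwist (NumberField.discr K : ℚ)).entireLFunction 1 ≠ 0)
    (Dt : ModularParametrizationData W (W.conductorNorm ℤ))
    (H : HeegnerDatum (W.conductorNorm ℤ) (NumberField.discr K)) (ι : K →+* ℂ)
    (P : (W.baseChange K).toAffine.Point)
    (hP : WeierstrassCurve.Affine.Point.map ι.toRatAlgHom P = heegnerPointComplex Dt H)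
    (Wd : WeierstrassCurve ℚ) [Wd.IsElliptic] [Wd.IsGloballyMinimal] (Cd : VariableChange ℚ)
    (hWd : Cd • W.quadraticTwist (NumberField.discr K : ℚ) = Wd) (hBd : BSDp Wd 2) :
    (∀ q : ℚ, shaAn W = (q : ℂ) → 0 ≤ padicValRat 2 q) ↔
      ∃ m : ℕ, HasTwoDivisibilityUpToTorsion W K P m ∧
        padicValNat 2 (Nat.card (AddCommGroup.primaryComponent Wd.sha 2)) +
            transpCount W (NumberField.discr K) + 2 * identCount W (NumberField.discr K) + 2 * padicValInt 2 Dt.c ≤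
          2 * m + (if W.Δ < 0 then 1 else 0) := by
  obtain ⟨-, -, -, -, ⟨m, hm⟩, huniq, q, hq, -, hval⟩ :=
    doorValuationC_at hmod hTam W hT hc hr hrQ K hK hGZ hKo hadm hHN hLt Dt H ι P hP Wd Cd hWd hBd
  have hv := hval m hm
  constructor
  · intro h
    have hle := h q hq
    refine ⟨m, hm, ?_⟩
    zify
    push_cast at hv hle ⊢
    linarith
  · rintro ⟨m', hm', hle⟩ q₁ hq₁
    have hmm : m' = m := huniq m' m hm' hm
    subst hmm
    have hqq : q₁ = q := by exact_mod_cast hq₁.symm.trans hq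
    subst hqq
    rw [hv]
    zify at hle
    push_cast at hle ⊢
    linarith

/-- The Euler-system half implies `2`-integrality of `#Ш_an(W)` (at a door datum, hence wherever the upper half is known):
`0 ≤ ord₂ #Ш(W) ≤ ord₂ #Ш_an(W)`. [cite: Miller2011LMS, Def. 1.1] -/
theorem padicValRat_shaAn_nonneg_of_missingUpperBoundAt_at
    (hmod : hasEntireLFunction_rat) (hTam : DoorTwistTamagawaAtTwo)
    (W : WeierstrassCurve ℚ) [W.IsElliptic] [W.IsGloballyMinimal] [NeZero (W.conductorNorm ℤ)]
    (hT : Odd W.torsionOrder) (hc : Odd W.tamagawaProduct) (hr : W.analyticRank = 1) (hrQ : W.mordellWeilRank = 1)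
    (K : Type) [Field K] [NumberField K] (hK : IsImaginaryQuadratic K)
    (hGZ : gross_zagier (W.conductorNorm ℤ) W K) (hKo : kolyvagin (W.conductorNorm ℤ) W K)
    (hadm : DoorAdmissible W (NumberField.discr K))
    (hHN : SatisfiesHeegnerHypothesis (W.conductorNorm ℤ) K)
    (hLt : (W.quadraticTwist (NumberField.discr K : ℚ)).entireLFunction 1 ≠ 0)
    (Dt : ModularParametrizationData W (W.conductorNorm ℤ))
    (H : HeegnerDatum (W.conductorNorm ℤ) (NumberField.discr K)) (ι : K →+* ℂ)
    (P : (W.baseChange K).toAffine.Point)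
    (hP : WeierstrassCurve.Affine.Point.map ι.toRatAlgHom P = heegnerPointComplex Dt H)
    (Wd : WeierstrassCurve ℚ) [Wd.IsElliptic] [Wd.IsGloballyMinimal] (Cd : VariableChange ℚ)
    (hWd : Cd • W.quadraticTwist (NumberField.discr K : ℚ) = Wd) (hBd : BSDp Wd 2) (hU : MissingUpperBoundAt W 2) :
    ∀ q : ℚ, shaAn W = (q : ℂ) → 0 ≤ padicValRat 2 q := by
  obtain ⟨m, hm, hle⟩ := (missingUpperBoundAt_two_iff_doorLawGeC_at hmod hTam W hT hc hr hrQ K hK hGZ hKo hadm hHN hLt Dt H ι P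
    hP Wd Cd hWd hBd).mp hU
  exact (padicValRat_shaAn_nonneg_iff_doorLawIntC_at hmod hTam W hT hc hr hrQ K hK hGZ hKo hadm hHN hLt Dt H ι P hP Wd Cd hWd
    hBd).mpr ⟨m, hm, by omega⟩

/-- **AN-28c at the datum ⟺ both one-sided laws** (bookkeeping; the exponent is unique): the full identity
`2m + [Δ<0] = s_E + s_d + t + 2s + 2·v₂(c)` holds for some exponent iff the `≤`-law and the `≥`-law each hold for some exponent.
[cite: GrossLMS1991, Conj. (2.2)] -/
theorem doorLawFullC_at_iff_geC_and_leC
    (hmod : hasEntireLFunction_rat) (hTam : DoorTwistTamagawaAtTwo)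
    (W : WeierstrassCurve ℚ) [W.IsElliptic] [W.IsGloballyMinimal] [NeZero (W.conductorNorm ℤ)]
    (hT : Odd W.torsionOrder) (hc : Odd W.tamagawaProduct) (hr : W.analyticRank = 1) (hrQ : W.mordellWeilRank = 1)
    (K : Type) [Field K] [NumberField K] (hK : IsImaginaryQuadratic K)
    (hGZ : gross_zagier (W.conductorNorm ℤ) W K) (hKo : kolyvagin (W.conductorNorm ℤ) W K)
    (hadm : DoorAdmissible W (NumberField.discr K))
    (hHN : SatisfiesHeegnerHypothesis (W.conductorNorm ℤ) K)
    (hLt : (W.quadraticTwist (NumberField.discr K : ℚ)).entireLFunction 1 ≠ 0)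
    (Dt : ModularParametrizationData W (W.conductorNorm ℤ))
    (H : HeegnerDatum (W.conductorNorm ℤ) (NumberField.discr K)) (ι : K →+* ℂ)
    (P : (W.baseChange K).toAffine.Point)
    (hP : WeierstrassCurve.Affine.Point.map ι.toRatAlgHom P = heegnerPointComplex Dt H)
    (Wd : WeierstrassCurve ℚ) [Wd.IsElliptic] [Wd.IsGloballyMinimal] (Cd : VariableChange ℚ)
    (hWd : Cd • W.quadraticTwist (NumberField.discr K : ℚ) = Wd) (hBd : BSDp Wd 2) :
    (∃ m : ℕ, HasTwoDivisibilityUpToTorsion W K P m ∧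
        2 * m + (if W.Δ < 0 then 1 else 0) =
          padicValNat 2 (Nat.card (AddCommGroup.primaryComponent W.sha 2)) +
            padicValNat 2 (Nat.card (AddCommGroup.primaryComponent Wd.sha 2)) +
            transpCount W (NumberField.discr K) + 2 * identCount W (NumberField.discr K) + 2 * padicValInt 2 Dt.c) ↔
      (∃ m : ℕ, HasTwoDivisibilityUpToTorsion W K P m ∧
        padicValNat 2 (Nat.card (AddCommGroup.primaryComponent W.sha 2)) +
            padicValNat 2 (Nat.card (AddCommGroup.primaryComponent Wd.sha 2)) +
            transpCount W (NumberField.discr K) + 2 * identCount W (NumberField.discr K) + 2 * padicValInt 2 Dt.c ≤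
          2 * m + (if W.Δ < 0 then 1 else 0)) ∧
      (∃ m : ℕ, HasTwoDivisibilityUpToTorsion W K P m ∧
        2 * m + (if W.Δ < 0 then 1 else 0) ≤
          padicValNat 2 (Nat.card (AddCommGroup.primaryComponent W.sha 2)) +
            padicValNat 2 (Nat.card (AddCommGroup.primaryComponent Wd.sha 2)) +
            transpCount W (NumberField.discr K) + 2 * identCount W (NumberField.discr K) + 2 * padicValInt 2 Dt.c) := by
  obtain ⟨-, -, -, -, -, huniq, -⟩ :=
    doorValuationC_at hmod hTam W hT hc hr hrQ K hK hGZ hKo hadm hHN hLt Dt H ι P hP Wd Cd hWd hBd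
  constructor
  · rintro ⟨m, hm, heq⟩
    exact ⟨⟨m, hm, heq.ge⟩, ⟨m, hm, heq.le⟩⟩
  · rintro ⟨⟨m, hm, hge⟩, ⟨m', hm', hle⟩⟩
    have hmm : m' = m := huniq m' m hm' hm
    subst hmm
    exact ⟨m', hm, le_antisymm hle hge⟩


/-! ### §3 Miller's `BSD(E,p)` from its two halves when the rank part and finiteness are known -/

/-- **`BSDp W p` ⟺ (lower half ∧ upper half)** for a curve whose Mordell–Weil rank equals its analytic rank and whose `Ш` is finite —
in particular on the whole slice of 23715 (Gross–Zagier–Kolyvagin).  Any `p`. [cite: Miller2011LMS, Def. 1.1] -/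
theorem bsdp_iff_missingLowerBoundAt_and_missingUpperBoundAt (W : WeierstrassCurve ℚ) [W.IsElliptic] (p : ℕ) [Fact p.Prime]
    (hrank : W.mordellWeilRank = W.analyticRank) (hfin : Finite W.sha) :
    BSDp W p ↔ MissingLowerBoundAt W p ∧ MissingUpperBoundAt W p := by
  haveI := hfin
  constructor
  · intro h
    exact lower_and_upper_of_missingPPartAt W p (missingPPartAt_of_bsdp W p h)
  · rintro ⟨hl, hu⟩
    obtain ⟨q, hq, hv⟩ := missingPPartAt_of_lower_of_upper W p hl hu
    refine ⟨hrank, Finite.of_injective _ Subtype.val_injective, q, hq, ?_⟩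
    rw [hv, WeierstrassCurve.shaOrder, padicValNat_card_addPrimaryComponent]

/-- On the slice of 23715 (analytic rank `1`, `rank E(ℚ) = 1`, `Ш(W)` finite — e.g. from `doorValuationC_at`):
`BSDp W 2` ⟺ both halves. [cite: Miller2011LMS, Def. 1.1] -/
theorem bsdp_two_iff_halves_of_rankOne (W : WeierstrassCurve ℚ) [W.IsElliptic]
    (hr : W.analyticRank = 1) (hrQ : W.mordellWeilRank = 1) (hfin : Finite W.sha) :
    BSDp W 2 ↔ MissingLowerBoundAt W 2 ∧ MissingUpperBoundAt W 2 :=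
  haveI : Fact (Nat.Prime 2) := ⟨Nat.prime_two⟩
  bsdp_iff_missingLowerBoundAt_and_missingUpperBoundAt W 2 (by rw [hrQ, hr]) hfin

end Summit.BirchSwinnertonDyer.BirchSwinnertonDyer.Theorems.RankOneAtTwoOneDoor

end
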